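import Summits.CriticalPhenomena.PercolationContinuityZ3.Theorems.PercNearOneGluingNoHeavyLowerTailThreePointIsoSexticPendantGraph
import Summits.CriticalPhenomena.PercolationContinuityZ3.Theorems.PercNearOneGluingNoHeavyLowerTailThreePointIsoSexticPendantSystem
import HarnessLib

/-!
# The full `(Q6)` SYSTEM passes from a cut vertex to every vertex behind it, and through parallel composition — every finite weighted graph

Support file for crux `stmt-CriticalPhenomena-4575` (`NoHeavyLowerTail`), seat `prim-facecert` gen 19 (`--supports stmt-CriticalPhenomena-4575`).
Graph-level form of `…ThreePointIsoSexticPendantSystem` (law level: each `(Q6)` component is preserved by arm/pendant extension of the port),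
in the cut-vertex setting of prim-l12-p1 gen 16's `…ThreePointVarianceBehindCutVertex` and the parallel-composition setting of p1 gen 21's
`…ThreePointIsoQuartic`; companion of `…ThreePointIsoSexticPendantGraph` (port component).  Lead memos
`run/shared/lean/prim/prim-l12/FROM-prim-nh-lead-4575-g115-Q6-LAW-ALGEBRA.md`, `…-g117-NONPORT-Q6.md`.

Isolation coordinates of terminals `a, b` and a port `h`: `Q = P(a|b|h)`, `A = P(h ↮ {a,b})`, `B = P(b ↮ {a,h})`, `C = P(a ↮ {b,h})`; the `(Q6)`
SYSTEM is `Q⁶ ≤ A²B³C³ ∧ Q⁶ ≤ A³B²C³ ∧ Q⁶ ≤ A³B³C²`.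
* `isoSexticSystem_behindCutVertex`: `c ∈ S`, `v,a,b ∉ S`, pairs `S × (V∖(S∪{v}))` of weight `0` (arbitrary arm hung at the port `v`):
  the system for `(a,b;v)` implies the system for `(a,b;c)` — off the null event the `(a,b;c)` coordinates are the mixtures
  `Q' = (1−r)Z + rQ`, `C' = (1−r)Z + rC`, `B' = (1−r)Z + rB`, `A' = (1−r) + rA` (`Z = P(a ≁ b)`, `r = P(v ↔ c inside the arm)`), and the law facts
  `C + B = Q + Z`, `Q ≤ A`, `A + Z ≤ 1 + Q` hold; then `ThreePointIsoSexticPendantSystem.isoSexticA/B_pendant` and `…Graph.isoSexticPort_iso`.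
* Parallel composition at `{a,b,c}` for the two non-port components: `…ThreePointIsoSexticSystemPieces` (`isoSexticA_of_pieces`,
  `isoSexticB_of_pieces`; the port component is `…Graph.isoSexticPort_of_pieces`).
So the FULL `(Q6)` system holds on every graph assembled from gadgets satisfying it (hubs, stars, series pieces: p1 `isoK_star`/`isoK_series` +
`ThreePointIsoQuartic.isoSextic_of_isoK`-type algebra) by arm extension of the port and parallel composition at the three terminals.
-/

namespace Summit.CriticalPhenomena.PercolationContinuityZ3.Theorems.ThreePointIsoSexticPendantSystemGraph

open MeasureTheory Set
open Literature.Probability.Percolation Literature.Probability.LatticeModels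
open Summit.CriticalPhenomena.PercolationContinuityZ3.Theorems.ThreePointVarianceCutVertex
open Summit.CriticalPhenomena.PercolationContinuityZ3.Theorems.ThreePointIsoSexticPendant
open Summit.CriticalPhenomena.PercolationContinuityZ3.Theorems.ThreePointIsoSexticPendantGraph

variable {V : Type*} [Fintype V] [DecidableEq V]

/-- **The full `(Q6)` SYSTEM passes from a cut vertex `v` to every vertex `c` behind it** (every finite weighted graph).
Setting: `c ∈ S`, `v, a, b ∉ S`, all pairs between `S` and `V ∖ (S ∪ {v})` of weight `0` (the part `S ∪ {v}` is an arbitrary arm hung at `v`).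
With `Q = P(a|b|v)`, `A = P(v ↮ {a,b})`, `B = P(b ↮ {a,v})`, `C = P(a ↮ {b,v})`: if `Q⁶ ≤ A²B³C³`, `Q⁶ ≤ A³B²C³` and `Q⁶ ≤ A³B³C²` then the same
three inequalities hold for `(a, b; c)`. [this work] -/
theorem isoSexticSystem_behindCutVertex (w : Sym2 V → unitInterval) {a b c v : V} (S : Finset V) (hc : c ∈ S) (hv : v ∉ S)
    (ha : a ∉ S) (hb : b ∉ S) (hw : ∀ u ∈ S, ∀ x, x ∉ S → x ≠ v → (w s(u, x) : ℝ) = 0)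
    (hyp : (prodBernoulli w).real ((openConn a b)ᶜ ∩ (openConn a v)ᶜ ∩ (openConn b v)ᶜ) ^ 6 ≤
      (prodBernoulli w).real ((openConn a v)ᶜ ∩ (openConn b v)ᶜ) ^ 2 *
        (prodBernoulli w).real ((openConn a b)ᶜ ∩ (openConn b v)ᶜ) ^ 3 *
          (prodBernoulli w).real ((openConn a b)ᶜ ∩ (openConn a v)ᶜ) ^ 3)
    (hypB : (prodBernoulli w).real ((openConn a b)ᶜ ∩ (openConn a v)ᶜ ∩ (openConn b v)ᶜ) ^ 6 ≤
      (prodBernoulli w).real ((openConn a v)ᶜ ∩ (openConn b v)ᶜ) ^ 3 *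
        (prodBernoulli w).real ((openConn a b)ᶜ ∩ (openConn b v)ᶜ) ^ 2 *
          (prodBernoulli w).real ((openConn a b)ᶜ ∩ (openConn a v)ᶜ) ^ 3)
    (hypA : (prodBernoulli w).real ((openConn a b)ᶜ ∩ (openConn a v)ᶜ ∩ (openConn b v)ᶜ) ^ 6 ≤
      (prodBernoulli w).real ((openConn a v)ᶜ ∩ (openConn b v)ᶜ) ^ 3 *
        (prodBernoulli w).real ((openConn a b)ᶜ ∩ (openConn b v)ᶜ) ^ 3 *
          (prodBernoulli w).real ((openConn a b)ᶜ ∩ (openConn a v)ᶜ) ^ 2) :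
    (prodBernoulli w).real ((openConn a b)ᶜ ∩ (openConn a c)ᶜ ∩ (openConn b c)ᶜ) ^ 6 ≤
        (prodBernoulli w).real ((openConn a c)ᶜ ∩ (openConn b c)ᶜ) ^ 2 *
          (prodBernoulli w).real ((openConn a b)ᶜ ∩ (openConn b c)ᶜ) ^ 3 *
            (prodBernoulli w).real ((openConn a b)ᶜ ∩ (openConn a c)ᶜ) ^ 3 ∧
      (prodBernoulli w).real ((openConn a b)ᶜ ∩ (openConn a c)ᶜ ∩ (openConn b c)ᶜ) ^ 6 ≤
        (prodBernoulli w).real ((openConn a c)ᶜ ∩ (openConn b c)ᶜ) ^ 3 *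
          (prodBernoulli w).real ((openConn a b)ᶜ ∩ (openConn b c)ᶜ) ^ 2 *
            (prodBernoulli w).real ((openConn a b)ᶜ ∩ (openConn a c)ᶜ) ^ 3 ∧
      (prodBernoulli w).real ((openConn a b)ᶜ ∩ (openConn a c)ᶜ ∩ (openConn b c)ᶜ) ^ 6 ≤
        (prodBernoulli w).real ((openConn a c)ᶜ ∩ (openConn b c)ᶜ) ^ 3 *
          (prodBernoulli w).real ((openConn a b)ᶜ ∩ (openConn b c)ᶜ) ^ 3 *
            (prodBernoulli w).real ((openConn a b)ᶜ ∩ (openConn a c)ᶜ) ^ 2 := by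
  have hN : (prodBernoulli w).real (bad S v) = 0 := real_bad w S v hw
  set μ := prodBernoulli w with hμ
  set T := (Finset.univ.filter fun z => z ∉ S) with hT
  set AB := reachIn T a b with hAB
  set AV := reachIn T a v with hAV
  set BV := reachIn T b v with hBV
  set In := reachIn (insert v S) c v with hIn
  have hdAB : DeterminedBy AB (↑(pairsIn T) : Set (Sym2 V)) := determinedBy_reachIn T a b
  have hdAV : DeterminedBy AV (↑(pairsIn T) : Set (Sym2 V)) := determinedBy_reachIn T a v
  have hdBV : DeterminedBy BV (↑(pairsIn T) : Set (Sym2 V)) := determinedBy_reachIn T b v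
  have hdIn : DeterminedBy In (↑(pairsIn (insert v S)) : Set (Sym2 V)) := determinedBy_reachIn _ c v
  have dAB := OneLayerTwoFinger.determinedBy_compl hdAB
  have dAV := OneLayerTwoFinger.determinedBy_compl hdAV
  have dBV := OneLayerTwoFinger.determinedBy_compl hdBV
  have nul := real_inter_compl_of_null w hN
  -- pointwise dictionary off the null event
  have iab : ∀ {ω}, ω ∉ bad S v → (ω ∈ openConn a b ↔ ω ∈ AB) :=
    fun hn => ThreePointVarianceBehindCutVertex.openConn_out_iff hv hn ha hb
  have iav : ∀ {ω}, ω ∉ bad S v → (ω ∈ openConn a v ↔ ω ∈ AV) :=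
    fun hn => ThreePointVarianceBehindCutVertex.openConn_out_iff hv hn ha hv
  have ibv : ∀ {ω}, ω ∉ bad S v → (ω ∈ openConn b v ↔ ω ∈ BV) :=
    fun hn => ThreePointVarianceBehindCutVertex.openConn_out_iff hv hn hb hv
  have iac : ∀ {ω}, ω ∉ bad S v → (ω ∈ openConn a c ↔ ω ∈ AV ∧ ω ∈ In) :=
    fun hn => ThreePointVarianceBehindCutVertex.openConn_ac_iff hv hn ha hc
  have ibc : ∀ {ω}, ω ∉ bad S v → (ω ∈ openConn b c ↔ ω ∈ BV ∧ ω ∈ In) :=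
    fun hn => ThreePointVarianceBehindCutVertex.openConn_ac_iff hv hn hb hc
  -- the `(a,b;v)` coordinates are outside-event probabilities
  have gQ : μ.real ((openConn a b)ᶜ ∩ (openConn a v)ᶜ ∩ (openConn b v)ᶜ) = μ.real (ABᶜ ∩ (AVᶜ ∩ BVᶜ)) := by
    rw [← nul ((openConn a b)ᶜ ∩ (openConn a v)ᶜ ∩ (openConn b v)ᶜ), ← nul (ABᶜ ∩ (AVᶜ ∩ BVᶜ))]
    congr 1; ext ω; simp only [mem_inter_iff, mem_compl_iff]
    constructor
    · rintro ⟨⟨⟨h1, h2⟩, h3⟩, hn⟩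
      exact ⟨⟨fun h => h1 ((iab hn).2 h), fun h => h2 ((iav hn).2 h), fun h => h3 ((ibv hn).2 h)⟩, hn⟩
    · rintro ⟨⟨h1, h2, h3⟩, hn⟩
      exact ⟨⟨⟨fun h => h1 ((iab hn).1 h), fun h => h2 ((iav hn).1 h)⟩, fun h => h3 ((ibv hn).1 h)⟩, hn⟩
  have gH : μ.real ((openConn a v)ᶜ ∩ (openConn b v)ᶜ) = μ.real (AVᶜ ∩ BVᶜ) := by
    rw [← nul ((openConn a v)ᶜ ∩ (openConn b v)ᶜ), ← nul (AVᶜ ∩ BVᶜ)]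
    congr 1; ext ω; simp only [mem_inter_iff, mem_compl_iff]
    constructor
    · rintro ⟨⟨h2, h3⟩, hn⟩; exact ⟨⟨fun h => h2 ((iav hn).2 h), fun h => h3 ((ibv hn).2 h)⟩, hn⟩
    · rintro ⟨⟨h2, h3⟩, hn⟩; exact ⟨⟨fun h => h2 ((iav hn).1 h), fun h => h3 ((ibv hn).1 h)⟩, hn⟩
  have gB : μ.real ((openConn a b)ᶜ ∩ (openConn b v)ᶜ) = μ.real (ABᶜ ∩ BVᶜ) := by
    rw [← nul ((openConn a b)ᶜ ∩ (openConn b v)ᶜ), ← nul (ABᶜ ∩ BVᶜ)]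
    congr 1; ext ω; simp only [mem_inter_iff, mem_compl_iff]
    constructor
    · rintro ⟨⟨h1, h3⟩, hn⟩; exact ⟨⟨fun h => h1 ((iab hn).2 h), fun h => h3 ((ibv hn).2 h)⟩, hn⟩
    · rintro ⟨⟨h1, h3⟩, hn⟩; exact ⟨⟨fun h => h1 ((iab hn).1 h), fun h => h3 ((ibv hn).1 h)⟩, hn⟩
  have gA : μ.real ((openConn a b)ᶜ ∩ (openConn a v)ᶜ) = μ.real (ABᶜ ∩ AVᶜ) := by
    rw [← nul ((openConn a b)ᶜ ∩ (openConn a v)ᶜ), ← nul (ABᶜ ∩ AVᶜ)]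
    congr 1; ext ω; simp only [mem_inter_iff, mem_compl_iff]
    constructor
    · rintro ⟨⟨h1, h2⟩, hn⟩; exact ⟨⟨fun h => h1 ((iab hn).2 h), fun h => h2 ((iav hn).2 h)⟩, hn⟩
    · rintro ⟨⟨h1, h2⟩, hn⟩; exact ⟨⟨fun h => h1 ((iab hn).1 h), fun h => h2 ((iav hn).1 h)⟩, hn⟩
  -- the `(a,b;c)` coordinates, as events built from `In` and outside events
  have gQ' : μ.real ((openConn a b)ᶜ ∩ (openConn a c)ᶜ ∩ (openConn b c)ᶜ) = μ.real (ABᶜ ∩ (Inᶜ ∪ (AVᶜ ∩ BVᶜ))) := by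
    rw [← nul ((openConn a b)ᶜ ∩ (openConn a c)ᶜ ∩ (openConn b c)ᶜ), ← nul (ABᶜ ∩ (Inᶜ ∪ (AVᶜ ∩ BVᶜ)))]
    congr 1; ext ω; simp only [mem_inter_iff, mem_compl_iff, mem_union]
    constructor
    · rintro ⟨⟨⟨h1, h2⟩, h3⟩, hn⟩
      rw [iab hn] at h1; rw [iac hn] at h2; rw [ibc hn] at h3
      exact ⟨⟨h1, by tauto⟩, hn⟩
    · rintro ⟨⟨h1, h23⟩, hn⟩
      rw [iab hn, iac hn, ibc hn]
      exact ⟨⟨⟨h1, by tauto⟩, by tauto⟩, hn⟩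
  have gH' : μ.real ((openConn a c)ᶜ ∩ (openConn b c)ᶜ) = μ.real (univ ∩ (Inᶜ ∪ (AVᶜ ∩ BVᶜ))) := by
    rw [← nul ((openConn a c)ᶜ ∩ (openConn b c)ᶜ), ← nul (univ ∩ (Inᶜ ∪ (AVᶜ ∩ BVᶜ)))]
    congr 1; ext ω; simp only [mem_inter_iff, mem_compl_iff, mem_union, mem_univ, true_and]
    constructor
    · rintro ⟨⟨h2, h3⟩, hn⟩
      rw [iac hn] at h2; rw [ibc hn] at h3
      exact ⟨by tauto, hn⟩
    · rintro ⟨h23, hn⟩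
      rw [iac hn, ibc hn]
      exact ⟨⟨by tauto, by tauto⟩, hn⟩
  have gB' : μ.real ((openConn a b)ᶜ ∩ (openConn b c)ᶜ) = μ.real (ABᶜ ∩ (Inᶜ ∪ BVᶜ)) := by
    rw [← nul ((openConn a b)ᶜ ∩ (openConn b c)ᶜ), ← nul (ABᶜ ∩ (Inᶜ ∪ BVᶜ))]
    congr 1; ext ω; simp only [mem_inter_iff, mem_compl_iff, mem_union]
    constructor
    · rintro ⟨⟨h1, h3⟩, hn⟩
      rw [iab hn] at h1; rw [ibc hn] at h3
      exact ⟨⟨h1, by tauto⟩, hn⟩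
    · rintro ⟨⟨h1, h3⟩, hn⟩
      rw [iab hn, ibc hn]
      exact ⟨⟨h1, by tauto⟩, hn⟩
  have gA' : μ.real ((openConn a b)ᶜ ∩ (openConn a c)ᶜ) = μ.real (ABᶜ ∩ (Inᶜ ∪ AVᶜ)) := by
    rw [← nul ((openConn a b)ᶜ ∩ (openConn a c)ᶜ), ← nul (ABᶜ ∩ (Inᶜ ∪ AVᶜ))]
    congr 1; ext ω; simp only [mem_inter_iff, mem_compl_iff, mem_union]
    constructor
    · rintro ⟨⟨h1, h2⟩, hn⟩
      rw [iab hn] at h1; rw [iac hn] at h2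
      exact ⟨⟨h1, by tauto⟩, hn⟩
    · rintro ⟨⟨h1, h2⟩, hn⟩
      rw [iab hn, iac hn]
      exact ⟨⟨h1, by tauto⟩, hn⟩
  -- mixture identities
  have hduniv : DeterminedBy (univ : Set (BondConfig V)) (↑(pairsIn T) : Set (Sym2 V)) := by
    rw [determinedBy_iff]; intro ω ω' _; simp
  set r := μ.real In with hr
  set Z := μ.real ABᶜ with hZ
  set Q := μ.real (ABᶜ ∩ (AVᶜ ∩ BVᶜ)) with hQ
  set IA := μ.real (ABᶜ ∩ AVᶜ) with hIA
  set IB := μ.real (ABᶜ ∩ BVᶜ) with hIB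
  set IH := μ.real (AVᶜ ∩ BVᶜ) with hIH
  have mQ : μ.real (ABᶜ ∩ (Inᶜ ∪ (AVᶜ ∩ BVᶜ))) = (1 - r) * Z + r * Q :=
    real_inter_compl_union w hv hdIn dAB (dAV.inter dBV)
  have mH : μ.real (univ ∩ (Inᶜ ∪ (AVᶜ ∩ BVᶜ))) = (1 - r) + r * IH := by
    rw [real_inter_compl_union w hv hdIn hduniv (dAV.inter dBV), probReal_univ, univ_inter]; ring
  have mB : μ.real (ABᶜ ∩ (Inᶜ ∪ BVᶜ)) = (1 - r) * Z + r * IB := real_inter_compl_union w hv hdIn dAB dBV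
  have mA : μ.real (ABᶜ ∩ (Inᶜ ∪ AVᶜ)) = (1 - r) * Z + r * IA := real_inter_compl_union w hv hdIn dAB dAV
  rw [gQ', gH', gB', gA', mQ, mH, mB, mA]
  rw [gQ, gH, gB, gA] at hyp hypA hypB
  -- the identity `IA + IB = Q + Z` (`a↔v ∧ b↔v ⟹ a↔b` outside `S`)
  have hcup : ABᶜ ∩ AVᶜ ∪ ABᶜ ∩ BVᶜ = ABᶜ := by
    ext ω; simp only [mem_union, mem_inter_iff, mem_compl_iff]
    constructor
    · rintro (⟨h, _⟩ | ⟨h, _⟩) <;> exact h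
    · intro h
      by_cases hav : ω ∈ AV
      · right; exact ⟨h, fun hbv => h (show ω ∈ AB from SimpleGraph.Reachable.trans hav (SimpleGraph.Reachable.symm hbv))⟩
      · left; exact ⟨h, hav⟩
  have hid : IA + IB = Q + Z := by
    have h1 := measureReal_union_add_inter (μ := μ) (s := ABᶜ ∩ AVᶜ) (t := ABᶜ ∩ BVᶜ) MeasurableSet.of_discrete
    rw [hcup, show ABᶜ ∩ AVᶜ ∩ (ABᶜ ∩ BVᶜ) = ABᶜ ∩ (AVᶜ ∩ BVᶜ) by ext ω; simp only [mem_inter_iff]; tauto] at h1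
    linarith
  -- two more law facts: `Q ≤ IH` and `x ≥ 0`, i.e. `IH + Z ≤ 1 + Q`
  have hQH : Q ≤ IH := measureReal_mono fun ω h => h.2
  have hxnn : IH + Z ≤ 1 + Q := by
    have h1 := measureReal_inter_add_sdiff (μ := μ) (s := AVᶜ ∩ BVᶜ) (t := ABᶜ) MeasurableSet.of_discrete
    have h2 : μ.real ((AVᶜ ∩ BVᶜ) \ ABᶜ) + μ.real ABᶜ ≤ 1 := by
      rw [← measureReal_union (Set.disjoint_left.2 fun ω h1 h2 => h1.2 h2) MeasurableSet.of_discrete]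
      exact measureReal_le_one
    have h3 : μ.real (AVᶜ ∩ BVᶜ ∩ ABᶜ) = Q := by
      rw [hQ]; congr 1; ext ω; simp only [mem_inter_iff]; tauto
    linarith
  have hIA : Q ≤ IA := measureReal_mono fun ω h => ⟨h.1, h.2.1⟩
  have hIB : Q ≤ IB := measureReal_mono fun ω h => ⟨h.1, h.2.2⟩
  have hr0 : 0 ≤ r := measureReal_nonneg
  have hr1 : r ≤ 1 := measureReal_le_one
  have hQ0 : 0 ≤ Q := measureReal_nonneg
  refine ⟨?_, ?_, ?_⟩
  · have key := isoSexticPort_iso (r := r) hQ0 (measureReal_mono fun ω h => h.1) (measureReal_mono fun ω h => h.1)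
      hid measureReal_nonneg measureReal_le_one hr0 hr1
      (by calc Q ^ 6 ≤ IH ^ 2 * IB ^ 3 * IA ^ 3 := hyp
        _ = IA ^ 3 * IB ^ 3 * IH ^ 2 := by ring)
    calc ((1 - r) * Z + r * Q) ^ 6 ≤ ((1 - r) * Z + r * IA) ^ 3 * ((1 - r) * Z + r * IB) ^ 3 * ((1 - r) + r * IH) ^ 2 := key
      _ = ((1 - r) + r * IH) ^ 2 * ((1 - r) * Z + r * IB) ^ 3 * ((1 - r) * Z + r * IA) ^ 3 := by ring
  · -- `I_b`-component: law cells `q = Q, u = IA − Q, t = IB − Q, s = IH − Q, x = 1 + Q − IH − Z`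
    have h := ThreePointIsoSexticPendantSystem.isoSexticB_pendant (x := 1 + Q - IH - Z) (s := IH - Q) (t := IB - Q) (u := IA - Q)
      (q := Q) (α := r) (by linarith) (by linarith) (by linarith) (by linarith) hQ0 (by linear_combination hid) hr0 hr1
      (by have e1 : Q + (IA - Q) = IA := by ring
          have e2 : Q + (IB - Q) = IB := by ring
          have e3 : Q + (IH - Q) = IH := by ring
          rw [e1, e2, e3]
          calc Q ^ 6 ≤ IH ^ 3 * IB ^ 2 * IA ^ 3 := hypB
            _ = IA ^ 3 * IB ^ 2 * IH ^ 3 := by ring)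
    have eZ : Q + (IB - Q) + (IA - Q) = Z := by linear_combination hid
    have e1 : Q + (IA - Q) = IA := by ring
    have e2 : Q + (IB - Q) = IB := by ring
    have e3 : Q + (IH - Q) = IH := by ring
    rw [eZ, e1, e2, e3] at h
    calc ((1 - r) * Z + r * Q) ^ 6 = (r * Q + (1 - r) * Z) ^ 6 := by ring
      _ ≤ (r * IA + (1 - r) * Z) ^ 3 * (r * IB + (1 - r) * Z) ^ 2 * (r * IH + (1 - r)) ^ 3 := h
      _ = ((1 - r) + r * IH) ^ 3 * ((1 - r) * Z + r * IB) ^ 2 * ((1 - r) * Z + r * IA) ^ 3 := by ring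
  · -- `I_a`-component
    have h := ThreePointIsoSexticPendantSystem.isoSexticA_pendant (x := 1 + Q - IH - Z) (s := IH - Q) (t := IB - Q) (u := IA - Q)
      (q := Q) (α := r) (by linarith) (by linarith) (by linarith) (by linarith) hQ0 (by linear_combination hid) hr0 hr1
      (by have e1 : Q + (IA - Q) = IA := by ring
          have e2 : Q + (IB - Q) = IB := by ring
          have e3 : Q + (IH - Q) = IH := by ring
          rw [e1, e2, e3]
          calc Q ^ 6 ≤ IH ^ 3 * IB ^ 3 * IA ^ 2 := hypA
            _ = IA ^ 2 * IB ^ 3 * IH ^ 3 := by ring)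
    have eZ : Q + (IB - Q) + (IA - Q) = Z := by linear_combination hid
    have e1 : Q + (IA - Q) = IA := by ring
    have e2 : Q + (IB - Q) = IB := by ring
    have e3 : Q + (IH - Q) = IH := by ring
    rw [eZ, e1, e2, e3] at h
    calc ((1 - r) * Z + r * Q) ^ 6 = (r * Q + (1 - r) * Z) ^ 6 := by ring
      _ ≤ (r * IA + (1 - r) * Z) ^ 2 * (r * IB + (1 - r) * Z) ^ 3 * (r * IH + (1 - r)) ^ 3 := h
      _ = ((1 - r) + r * IH) ^ 3 * ((1 - r) * Z + r * IB) ^ 3 * ((1 - r) * Z + r * IA) ^ 2 := by ring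

end Summit.CriticalPhenomena.PercolationContinuityZ3.Theorems.ThreePointIsoSexticPendantSystemGraph
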